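import Literature.Computability.QuantumComplexity.RevUncomputeUniformShift
import Literature.Computability.QuantumComplexity.CleanBlockDesc
import HarnessLib

/-!
# The description of a shifted garbage-free block is polynomial time

Companion of `CleanBlockDesc.lean` (`RevClean.flatMap_opBits_cleanOps_mem_FP`: the description
bits of the clean block `cleanOps e M (n₀ u) (v u)` at its canonical position are a
polynomial-time function of `1ᵘ`) for blocks placed at an **offset** `S(u)` inside a larger
register — `(cleanOps e M (N u) []).map (ClOp.map (· + S u))`, the form used by the
time-multiplexed classical wrap in preparation (sequel of `ClassicalWrapGadgets.lean`), whose
`h`- and `g`-blocks sit behind the front window. With an empty suffix the block is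
`comp ++ outOps ++ reverse comp`; the two forward pieces are rendered from the shifting printer
`ogShift S` (`RevUncomputeUniformShift.out_compGW_shift`, `out_outGW_shift`,
`GStmt.render_out_mem_FP`), the reversed tableau from the backward shifting printer `ogShiftR S`
and string reversal (`reverse_out_compGWR_shift`, `render_reverse_out_mem_FP`), and the pieces
are concatenated (`append_mem_FP`): **`flatMap_opBits_cleanOps_shift_mem_FP`**.
(Arora–Barak 2009, Remark 6.7; Bernstein–Vazirani 1997, §8.)

## References

* S. Arora, B. Barak, *Computational Complexity: A Modern Approach*, CUP 2009, §6.2 and proof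
  of Thm. 6.15, Remark 6.7.
* E. Bernstein, U. Vazirani, *Quantum complexity theory*, SIAM J. Comput. 26 (1997), §8.
-/

noncomputable section

namespace Literature.Computability.QuantumComplexity

namespace RevClean

open _root_.Computability Complexity Turing RevDesc RevSim

variable (e : ℕ) (M : TM2ComputableAux Bool Bool)

/-- **The forward generator of a shifted clean block** (empty suffix): compute half and
read-out through the shifting printer. [folklore] -/
def fwdShiftG (S NE : GE) : GS := GStmt.seq (compGW e M (ogShift S) NE) (outGW e M (ogShift S) NE)

/-- **The backward generator of a shifted clean block**: the compute half through the backward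
shifting printer (to be reversed). [folklore] -/
def bwdShiftG (S NE : GE) : GS := compGW e M (ogShiftR S) NE

variable {e M}

/-- The empty suffix has no gadget. [folklore] -/
theorem notsV_nil' (n₀ : ℕ) : notsV n₀ [] = [] := by simp [notsV]

/-- **The forward generator prints the shifted `comp ++ outOps`.** [folklore] -/
theorem out_fwdShiftG {S NE : GE} (hS : InUU S) (hNE : InUU NE) (env : GV → ℕ) :
    (fwdShiftG e M S NE).out env =
      ((comp e M (NE.eval env) ++ outOps e M (NE.eval env)).map (ClOp.map (· + S.eval env))).flatMap opToks := by
  rw [fwdShiftG, GStmt.out, out_compGW_shift hS hNE, out_outGW_shift hS hNE, List.map_append, List.flatMap_append]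

/-- Loop variables of the forward generator. [folklore] -/
theorem uu_notMem_loopVars_fwdShiftG (S NE : GE) : GV.uu ∉ (fwdShiftG e M S NE).loopVars := by
  intro h
  rw [fwdShiftG, GStmt.loopVars, List.mem_append] at h
  rcases h with h | h
  · rcases loopVars_compGW_sub (loopVars_ogShift_sub S) NE _ h with h | h | h <;> exact absurd h (by decide)
  · rcases loopVars_outGW_sub (loopVars_ogShift_sub S) NE _ h with h | h | h <;> exact absurd h (by decide)

/-- Non-reuse of the forward generator. [folklore] -/
theorem noReuse_fwdShiftG (S NE : GE) : (fwdShiftG e M S NE).noReuse = true :=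
  noReuse_seq_of (noReuse_compGW (loopVars_ogShift_sub S) (noReuse_ogShift S) NE)
    (noReuse_outGW (loopVars_ogShift_sub S) (noReuse_ogShift S) NE)

/-- Loop variables of the backward generator. [folklore] -/
theorem uu_notMem_loopVars_bwdShiftG (S NE : GE) : GV.uu ∉ (bwdShiftG e M S NE).loopVars := fun h => by
  rcases loopVars_compGW_sub (loopVars_ogShiftR_sub S) NE _ h with h | h | h <;> exact absurd h (by decide)

/-- Non-reuse of the backward generator. [folklore] -/
theorem noReuse_bwdShiftG (S NE : GE) : (bwdShiftG e M S NE).noReuse = true :=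
  noReuse_compGW (loopVars_ogShiftR_sub S) (noReuse_ogShiftR S) NE

/-- **The description of a shifted clean block is polynomial time.** For a data length `N(u)` and
an offset `S(u)` given by expressions in the family index, the map
`1ᵘ ↦ ((cleanOps e M (N u) []).map (· + S u)).flatMap opBits` is in `FP`.
[cite: AroraBarak2009, §6.2 Def. 6.12 and Remark 6.7 (descriptions printed in polynomial time)] -/
theorem flatMap_opBits_cleanOps_shift_mem_FP {S NE : GE} (hS : InUU S) (hNE : InUU NE) :
    (fun z : List Bool => ((cleanOps e M (NE.eval (envU z.length)) []).map
      (ClOp.map (· + S.eval (envU z.length)))).flatMap opBits) ∈ FP := by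
  have h1 := GStmt.render_out_mem_FP (fwdShiftG e M S NE) GV.uu (uu_notMem_loopVars_fwdShiftG S NE) (noReuse_fwdShiftG S NE)
  have h2 := render_reverse_out_mem_FP (bwdShiftG e M S NE) GV.uu (uu_notMem_loopVars_bwdShiftG S NE) (noReuse_bwdShiftG S NE)
  have h := append_mem_FP h1 h2
  refine (congrArg (· ∈ FP) (funext fun z => ?_)).mpr h
  set u := z.length
  have e1 : Tok.render 0 ((fwdShiftG e M S NE).out (GenProg.initEnv GV.uu u)) =
      ((comp e M (NE.eval (envU u)) ++ outOps e M (NE.eval (envU u))).map (ClOp.map (· + S.eval (envU u)))).flatMap opBits := by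
    rw [show GenProg.initEnv GV.uu u = envU u from rfl, out_fwdShiftG hS hNE, render_flatMap_opToks_nil]
  have e2 : Tok.render 0 ((bwdShiftG e M S NE).out (GenProg.initEnv GV.uu u)).reverse =
      ((comp e M (NE.eval (envU u))).map (ClOp.map (· + S.eval (envU u)))).reverse.flatMap opBits := by
    rw [show GenProg.initEnv GV.uu u = envU u from rfl, bwdShiftG, reverse_out_compGWR_shift hS hNE, render_flatMap_opToks_nil]
  change _ = Tok.render 0 ((fwdShiftG e M S NE).out (GenProg.initEnv GV.uu u)) ++
    Tok.render 0 ((bwdShiftG e M S NE).out (GenProg.initEnv GV.uu u)).reverse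
  rw [e1, e2, cleanOps, notsV_nil', List.nil_append, List.append_nil, List.length_nil, Nat.add_zero]
  simp only [List.map_append, List.map_reverse, List.flatMap_append, List.append_assoc]

end RevClean

end Literature.Computability.QuantumComplexity
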